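import Summits.QuantumAdvantage.QuantumAdvantage.Theorems.CubicForrelationNearExactIsExactTwelveLevelSixCrossCoset

/-!
# Crux `CubicForrelation.NearExactIsExact` (stmt-QuantumAdvantage-14043) — n = 12, level ≥ 6: flat sums of the residual `e = W_g/64 − (−1)^f`
  (`4 ∣ Σ_{6-flat} e`, `8 ∣ Σ_{7-flat} e`), factored out of the off-flat analyses

Certificate seat `b2b-cforr-cert` (gen 15).  HONEST FRAMING: two bookkeeping lemmas (standard axioms) about cubic Boolean pairs on 12 bits, used by
the off-flat trichotomy at budget `≤ 664` (`tw15_off_flat_le152`); they are the inlined `hflat6`/`hflat7` of `tw15_off_flat_le128/136`.  Finite-slice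
bookkeeping, NOT summit progress.

`tw15_e_flat6` / `tw15_e_flat7`: for cubic `f, g` with `W_g = 64u''` and `e = u'' − (−1)^f`, every parametrised 6-flat sum of `e` is `≡ 0 (mod 4)` and
every 7-flat sum is `≡ 0 (mod 8)` (flat sums of `W_g/16 = 4u''` are divisible by `16`, `32` (`fs_flat_sum_dvd`), and Ax for `f` gives `4 ∣`, `8 ∣`
for the sums of `(−1)^f` (`sl_sum_sZ_flat`)).

References: J. Ax (1964) / R. J. McEliece (1972); MacWilliams–Sloane (1977) Ch. 13 §3.  Axioms: the standard three.
-/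

set_option linter.dupNamespace false -- D-0017: single-problem summit ⇒ `QuantumAdvantage.QuantumAdvantage` by design

noncomputable section

namespace Summit.QuantumAdvantage.QuantumAdvantage.Theorems.CubicForrelation.NearExactIsExact

open Finset
open Literature.Computability.QuantumComplexity
open Literature.Computability.QuantumComplexity.DerivativeWalsh (W)

/-! ### Flat sums of the level-6 residual -/

/-- **`4 ∣ Σ_{6-flat} (u'' − (−1)^f)`** for cubic `f, g` with `W_g = 64u''`. [this work] -/
theorem tw15_e_flat6 (f g : (Fin (6 + 6) → Bool) → Bool) (hf : IsDegLeFun 3 f) (hg : IsDegLeFun 3 g)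
    (u'' : (Fin (6 + 6) → Bool) → ℤ) (hu'' : ∀ x, W (fun y => signOf (g y)) x = (2 : ℝ) ^ 6 * (u'' x : ℝ))
    (b : Fin (6 + 6) → Bool) (a : Fin 6 → Fin (6 + 6) → Bool) :
    (4 : ℤ) ∣ ∑ ε : Fin 6 → Bool, (u'' (fun j => b j ^^ decide (Odd #(univ.filter fun i => ε i && a i j))) -
      sZ (f (fun j => b j ^^ decide (Odd #(univ.filter fun i => ε i && a i j))))) := by
  classical
  set u : (Fin (6 + 6) → Bool) → ℤ := fun x => 4 * u'' x with hudef
  have hu : ∀ x, W (fun y => signOf (g y)) x = (2 : ℝ) ^ 4 * (u x : ℝ) := by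
    intro x; rw [hu'' x]; simp only [u]; push_cast; ring
  have h1 := fs_flat_sum_dvd (e := 4) g u hg hu b a (by norm_num)
  obtain ⟨zf, hzf⟩ := sl_sum_sZ_flat f hf b a
  have hzf' : ∑ ε : Fin 6 → Bool, 4 * sZ (f (fun j => b j ^^ decide (Odd #(univ.filter fun i => ε i && a i j)))) = 16 * zf := by
    rw [← mul_sum, hzf]; norm_num; ring
  have h1' : (16 : ℤ) ∣ ∑ ε : Fin 6 → Bool, u (fun j => b j ^^ decide (Odd #(univ.filter fun i => ε i && a i j))) := by
    have e16 : (2 : ℤ) ^ 4 = 16 := by norm_num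
    rw [e16] at h1; exact h1
  have h2 : (16 : ℤ) ∣ ∑ ε : Fin 6 → Bool, (u (fun j => b j ^^ decide (Odd #(univ.filter fun i => ε i && a i j))) -
      4 * sZ (f (fun j => b j ^^ decide (Odd #(univ.filter fun i => ε i && a i j))))) := by
    rw [sum_sub_distrib, hzf']
    exact dvd_sub h1' (Dvd.intro _ rfl)
  have h3 : ∑ ε : Fin 6 → Bool, (u (fun j => b j ^^ decide (Odd #(univ.filter fun i => ε i && a i j))) -
      4 * sZ (f (fun j => b j ^^ decide (Odd #(univ.filter fun i => ε i && a i j))))) =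
      4 * ∑ ε : Fin 6 → Bool, (u'' (fun j => b j ^^ decide (Odd #(univ.filter fun i => ε i && a i j))) -
        sZ (f (fun j => b j ^^ decide (Odd #(univ.filter fun i => ε i && a i j))))) := by
    rw [mul_sum]; exact sum_congr rfl fun ε _ => by simp only [u]; ring
  rw [h3] at h2
  obtain ⟨k, hk⟩ := h2
  exact ⟨k, by linarith⟩

/-- **`8 ∣ Σ_{7-flat} (u'' − (−1)^f)`** for cubic `f, g` with `W_g = 64u''`. [this work] -/
theorem tw15_e_flat7 (f g : (Fin (6 + 6) → Bool) → Bool) (hf : IsDegLeFun 3 f) (hg : IsDegLeFun 3 g)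
    (u'' : (Fin (6 + 6) → Bool) → ℤ) (hu'' : ∀ x, W (fun y => signOf (g y)) x = (2 : ℝ) ^ 6 * (u'' x : ℝ))
    (b : Fin (6 + 6) → Bool) (a : Fin 7 → Fin (6 + 6) → Bool) :
    (8 : ℤ) ∣ ∑ ε : Fin 7 → Bool, (u'' (fun j => b j ^^ decide (Odd #(univ.filter fun i => ε i && a i j))) -
      sZ (f (fun j => b j ^^ decide (Odd #(univ.filter fun i => ε i && a i j))))) := by
  classical
  set u : (Fin (6 + 6) → Bool) → ℤ := fun x => 4 * u'' x with hudef
  have hu : ∀ x, W (fun y => signOf (g y)) x = (2 : ℝ) ^ 4 * (u x : ℝ) := by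
    intro x; rw [hu'' x]; simp only [u]; push_cast; ring
  have h1 := fs_flat_sum_dvd (e := 5) g u hg hu b a (by norm_num)
  obtain ⟨zf, hzf⟩ := sl_sum_sZ_flat f hf b a
  have hzf' : ∑ ε : Fin 7 → Bool, 4 * sZ (f (fun j => b j ^^ decide (Odd #(univ.filter fun i => ε i && a i j)))) = 32 * zf := by
    rw [← mul_sum, hzf]; norm_num; ring
  have h1' : (32 : ℤ) ∣ ∑ ε : Fin 7 → Bool, u (fun j => b j ^^ decide (Odd #(univ.filter fun i => ε i && a i j))) := by
    have e32 : (2 : ℤ) ^ 5 = 32 := by norm_num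
    rw [e32] at h1; exact h1
  have h2 : (32 : ℤ) ∣ ∑ ε : Fin 7 → Bool, (u (fun j => b j ^^ decide (Odd #(univ.filter fun i => ε i && a i j))) -
      4 * sZ (f (fun j => b j ^^ decide (Odd #(univ.filter fun i => ε i && a i j))))) := by
    rw [sum_sub_distrib, hzf']
    exact dvd_sub h1' (Dvd.intro _ rfl)
  have h3 : ∑ ε : Fin 7 → Bool, (u (fun j => b j ^^ decide (Odd #(univ.filter fun i => ε i && a i j))) -
      4 * sZ (f (fun j => b j ^^ decide (Odd #(univ.filter fun i => ε i && a i j))))) =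
      4 * ∑ ε : Fin 7 → Bool, (u'' (fun j => b j ^^ decide (Odd #(univ.filter fun i => ε i && a i j))) -
        sZ (f (fun j => b j ^^ decide (Odd #(univ.filter fun i => ε i && a i j))))) := by
    rw [mul_sum]; exact sum_congr rfl fun ε _ => by simp only [u]; ring
  rw [h3] at h2
  obtain ⟨k, hk⟩ := h2
  exact ⟨k, by linarith⟩

end Summit.QuantumAdvantage.QuantumAdvantage.Theorems.CubicForrelation.NearExactIsExact

end
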